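import Summits.RiemannHypothesis.RiemannHypothesis.Theorems.GroundBartaEvenWinsBeyondArchPhantomRipples
import Literature.NumberTheory.LFunctions.WeilArchimedeanMoments
import HarnessLib

/-!
# RiemannHypothesis / GroundBarta machinery — the PHANTOM MINORANT bound (level test with invisible frequencies)

Helper file (`--supports stmt-RiemannHypothesis-18085`; infrastructure for the Weil-positivity ladder of routes
GroundBarta / WeilParity / WeilPos), RH-free.  Seat rh-explicit-weil-3 (structure seat; memo
`run/shared/lean/pub/rh-explicit/WEIL3-STRUCTURE.md` §3.5), on top of seat rh-explicit-weil-1's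
`GroundBartaEvenWinsBeyondArchPhantomRipples.lean` (`phantomRipple`, `integral_norm_sq_weilMellin_mul_phantomRipple_eq_zero`:
for `tsupport g ⊆ [-c, c]` every finite cosine sum `P(t) = Σ_m A_m cos(t x_m)` with all `|x_m| ≥ 2c` integrates
to zero against `|ĝ(1/2+it)|²`).

The Yoshida-type moment certificates (`Literature.NumberTheory.LFunctions.WeilCert*`) bound the weighted
Plancherel form `(1/2π) ∫ |ĝ(1/2+it)|² w(t) dt` of the analytic form `E_N` from below through a POINTWISE minorant
`level − γ(t) ≤ w(t)` (`γ` compactly supported, paid for in moments; beyond its support the "level test"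
`level ≤ w(t)` is certified with `|cos| ≤ 1` on every prime ripple of `w`).  Here is the same step with a phantom
ripple added to the minorant, which costs nothing:

* `le_integral_norm_sq_weilMellin_mul_of_phantom_minorant` — if `level + P(t) − γ(t) ≤ w(t)` for all real `t`,
  `P` a phantom ripple with frequencies `|x_m| ≥ 2c`, then
  `level · ∫ |ĝ(1/2+it)|² dt − ∫ |ĝ(1/2+it)|² γ(t) dt ≤ ∫ |ĝ(1/2+it)|² w(t) dt`;
* `mul_integral_norm_sq_weilMellin_le_of_phantom_minorant`, `mul_weilNorm2Sq_le_of_phantom_minorant` — the case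
  `γ = 0`: `level + P ≤ w` pointwise gives `level · ∫|ĝ|² ≤ ∫|ĝ|² w`, i.e. `2π · level · ‖g‖₂² ≤ ∫|ĝ|² w`
  (Plancherel `integral_norm_sq_weilMellin_half_line`).

Why it matters (memo §3.4–3.5; weil-1's `WEIL1-SIZELAW.md`): with `P = 0` the level a weight
`w_N = Re ψ(1/4+it/2) − Σ_{n≤N} (Λ(n)/√n) 2cos(t log n)` can carry beyond a cut-off `T` is `Re ψ(1/4+iT/2) − A`,
`A = Σ 2Λ(n)/√n` (all ripples aligned); choosing for each prime `p` the harmonics `cos(j t log p)` with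
`p^j ≥ e^{2c}` as phantoms replaces `A` by the value of a one-variable Fejér–Riesz extremal problem, about `A/2`
(e.g. `4.38 → 2.24` on the window `c = (log 7)/2`), and the cut-off `T` — hence the moment order `N ≈ e·c·T` —
by the corresponding exponential factor.  Everything here is proved; there are no named facts.

## References

* H. Yoshida, *On Hermitian forms attached to zeta functions*, Adv. Stud. Pure Math. 21 (1992), §6 (the level /
  monotonicity step of the certificate at `a = (log 2)/2`).
* L. Fejér, *Über trigonometrische Polynome*, J. reine angew. Math. 146 (1916); E. Egerváry, O. Szász, *Einige
  Extremalprobleme im Bereiche der trigonometrischen Polynome*, Math. Z. 27 (1928) (the extremal problem behind the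
  choice of the phantom amplitudes — not used in the proofs below).
-/

set_option linter.dupNamespace false

noncomputable section

open Complex Filter Set MeasureTheory
open scoped Real Topology ComplexConjugate

namespace Summit.RiemannHypothesis.RiemannHypothesis.Theorems.EvenWinsBeyondArch

open Literature.NumberTheory.LFunctions

variable {g : ℝ → ℂ}

/-- **The phantom minorant bound.**  Let `g` be a Weil test function with `tsupport g ⊆ [-c, c]`, `w` a weight and
`γ` a correction, both integrable against `|ĝ(1/2+it)|²`, and `P = phantomRipple ps` a finite cosine sum all of
whose frequencies satisfy `2c ≤ |x_m|`.  If `level + P(t) − γ(t) ≤ w(t)` for every real `t`, then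
`level · ∫ |ĝ(1/2+it)|² dt − ∫ |ĝ(1/2+it)|² γ(t) dt ≤ ∫ |ĝ(1/2+it)|² w(t) dt` — the phantom ripple drops out
(`integral_norm_sq_weilMellin_mul_phantomRipple_eq_zero`). [cite: Yoshida1992HermitianForms, §6 (level/monotonicity step), with invisible frequencies added to the minorant] -/
theorem le_integral_norm_sq_weilMellin_mul_of_phantom_minorant (hg : IsWeilTest g) {c : ℝ}
    (hsupp : tsupport g ⊆ Icc (-c) c) {ps : List (ℝ × ℝ)} (hps : ∀ p ∈ ps, 2 * c ≤ |p.2|)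
    {w γ : ℝ → ℝ} {level : ℝ}
    (hw : Integrable fun t : ℝ ↦ ‖weilMellin g (1 / 2 + t * I)‖ ^ 2 * w t)
    (hγ : Integrable fun t : ℝ ↦ ‖weilMellin g (1 / 2 + t * I)‖ ^ 2 * γ t)
    (hmin : ∀ t : ℝ, level + phantomRipple ps t - γ t ≤ w t) :
    level * (∫ t : ℝ, ‖weilMellin g (1 / 2 + t * I)‖ ^ 2) -
        ∫ t : ℝ, ‖weilMellin g (1 / 2 + t * I)‖ ^ 2 * γ t ≤
      ∫ t : ℝ, ‖weilMellin g (1 / 2 + t * I)‖ ^ 2 * w t := by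
  have hP0 : Integrable fun t : ℝ ↦ ‖weilMellin g (1 / 2 + t * I)‖ ^ 2 :=
    integrable_norm_sq_weilMellin_half_line hg
  have hPh : Integrable fun t : ℝ ↦ ‖weilMellin g (1 / 2 + t * I)‖ ^ 2 * phantomRipple ps t :=
    integrable_norm_sq_weilMellin_mul_phantomRipple hg ps
  -- the minorant integrated against `|ĝ|²`
  have h1 : Integrable fun t : ℝ ↦ level * ‖weilMellin g (1 / 2 + t * I)‖ ^ 2 +
      ‖weilMellin g (1 / 2 + t * I)‖ ^ 2 * phantomRipple ps t :=
    (hP0.const_mul level).add hPh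
  have hM : Integrable fun t : ℝ ↦ level * ‖weilMellin g (1 / 2 + t * I)‖ ^ 2 +
      ‖weilMellin g (1 / 2 + t * I)‖ ^ 2 * phantomRipple ps t -
        ‖weilMellin g (1 / 2 + t * I)‖ ^ 2 * γ t :=
    h1.sub hγ
  have hle : ∀ t : ℝ, level * ‖weilMellin g (1 / 2 + t * I)‖ ^ 2 +
      ‖weilMellin g (1 / 2 + t * I)‖ ^ 2 * phantomRipple ps t -
        ‖weilMellin g (1 / 2 + t * I)‖ ^ 2 * γ t ≤ ‖weilMellin g (1 / 2 + t * I)‖ ^ 2 * w t := by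
    intro t
    have h0 : 0 ≤ ‖weilMellin g (1 / 2 + t * I)‖ ^ 2 := by positivity
    have h1 := mul_le_mul_of_nonneg_left (hmin t) h0
    nlinarith [h1]
  have hint := integral_mono hM hw hle
  rw [integral_sub h1 hγ, integral_add (hP0.const_mul level) hPh,
    integral_const_mul, integral_norm_sq_weilMellin_mul_phantomRipple_eq_zero hg hsupp hps, add_zero] at hint
  exact hint

/-- **The phantom level test** (case `γ = 0`): if `level + P(t) ≤ w(t)` for all `t` with `P` a phantom ripple of
frequencies `|x_m| ≥ 2c`, then `level · ∫ |ĝ(1/2+it)|² dt ≤ ∫ |ĝ(1/2+it)|² w(t) dt` for every Weil test `g`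
supported in `[-c, c]`. [cite: Yoshida1992HermitianForms, §6 (level/monotonicity step), with invisible frequencies added to the minorant] -/
theorem mul_integral_norm_sq_weilMellin_le_of_phantom_minorant (hg : IsWeilTest g) {c : ℝ}
    (hsupp : tsupport g ⊆ Icc (-c) c) {ps : List (ℝ × ℝ)} (hps : ∀ p ∈ ps, 2 * c ≤ |p.2|)
    {w : ℝ → ℝ} {level : ℝ}
    (hw : Integrable fun t : ℝ ↦ ‖weilMellin g (1 / 2 + t * I)‖ ^ 2 * w t)
    (hmin : ∀ t : ℝ, level + phantomRipple ps t ≤ w t) :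
    level * (∫ t : ℝ, ‖weilMellin g (1 / 2 + t * I)‖ ^ 2) ≤
      ∫ t : ℝ, ‖weilMellin g (1 / 2 + t * I)‖ ^ 2 * w t := by
  have hγ : Integrable fun t : ℝ ↦ ‖weilMellin g (1 / 2 + t * I)‖ ^ 2 * (0 : ℝ) := by
    simp
  have h := le_integral_norm_sq_weilMellin_mul_of_phantom_minorant hg hsupp hps hw hγ
    (fun t ↦ by simpa using hmin t)
  simpa using h

/-- The phantom level test against `‖g‖₂²` (Plancherel `∫ |ĝ(1/2+it)|² dt = 2π ‖g‖₂²`):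
`2π · level · ‖g‖₂² ≤ ∫ |ĝ(1/2+it)|² w(t) dt`. [cite: Yoshida1992HermitianForms, §6 (level/monotonicity step), with invisible frequencies added to the minorant] -/
theorem mul_weilNorm2Sq_le_of_phantom_minorant (hg : IsWeilTest g) {c : ℝ}
    (hsupp : tsupport g ⊆ Icc (-c) c) {ps : List (ℝ × ℝ)} (hps : ∀ p ∈ ps, 2 * c ≤ |p.2|)
    {w : ℝ → ℝ} {level : ℝ}
    (hw : Integrable fun t : ℝ ↦ ‖weilMellin g (1 / 2 + t * I)‖ ^ 2 * w t)
    (hmin : ∀ t : ℝ, level + phantomRipple ps t ≤ w t) :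
    2 * π * level * weilNorm2Sq g ≤ ∫ t : ℝ, ‖weilMellin g (1 / 2 + t * I)‖ ^ 2 * w t := by
  have h := mul_integral_norm_sq_weilMellin_le_of_phantom_minorant hg hsupp hps hw hmin
  rw [integral_norm_sq_weilMellin_half_line hg] at h
  linarith [h]

end Summit.RiemannHypothesis.RiemannHypothesis.Theorems.EvenWinsBeyondArch

end
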